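import Mathlib.FieldTheory.IsAlgClosed.AlgebraicClosure
import Mathlib.RingTheory.RootsOfUnity.AlgebraicallyClosed
import Mathlib.Algebra.MvPolynomial.Variables
import Literature.FieldTheory.Kummer.DivisionSequences
import Literature.FieldTheory.Kummer.KummerFiniteRank
import Literature.FieldTheory.Kummer.KummerRadicals
import Literature.FieldTheory.Kummer.RadicalBoundFG
import HarnessLib

/-!
# Proof of `BaysKirby2018_divisionSequences_determined` (Bays–Kirby 2018, Prop. 3.22/3.24)

We discharge the named fact `Literature.FieldTheory.Kummer.BaysKirby2018_divisionSequences_determined`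
(`DivisionSequences.lean`): division sequences below a good division point are determined
(Zilber's Thumbtack Lemma over `ℚ(μ_∞)`-based fields; Bays–Zilber 2011, Thm 2.3; Kirby 2013,
Fact 3.7; Bays–Kirby 2018, Prop. 3.22 with Prop. 3.24). The proof assembles:

* `RadicalBoundFG.exists_dvd_of_mem_closure_fg` — radicals of `⟨b, c⟩ μ` in the finitely
  generated field `K = ℚ(μ, S, b, c)` have bounded denominators `m₀` (Bays–Zilber Prop. 2.5:
  Dirichlet `S`-units + Schinzel-type descent + Kummer theory over function fields);
* `KummerRadicals.exists_eq_mul_prod_pow` — radicals of `E` inside `E(y₁, …, y_k)` are monomials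
  (Lang VI §8 Thm 8.2), used for `L = M(c')` over `M = ℚ(μ, S, b^ℚ, c)` and for the Kummer
  tower `M = ⋃_N K(b^{1/N})` over `K`;
* `KummerFiniteRank.isMaximal_kummerIdeal` — over `L`, independence of `c'` modulo `k`-th powers
  for every `k` makes each level's Kummer ideal maximal, so the ideal of relations of any division
  system below `c'`, in any field, is the generic one;
* a reduction to algebraically closed `Ω` (embed into `AlgebraicClosure Ω`, extend the base
  `L ⊆ Ω` to `L' ⊆ Ω̄` and `L → Ω₂` to `L' → AlgebraicClosure Ω₂` by `IsAlgClosed.lift`).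

Main results: `Literature.FieldTheory.Kummer.DivisionSequencesProofs.indepModPowers_baseTuple`
(with `m = m₀`: every `m`-th root `c'` of `c` is Kummer-independent over `L` at all levels),
`Literature.FieldTheory.Kummer.DivisionSequencesProofs.ker_aeval_divisionSystem_eq`, and
`Literature.FieldTheory.Kummer.BaysKirby2018_divisionSequences_determined_holds`.

## References

* M. Bays, J. Kirby, *Pseudo-exponential maps, variants, and quasiminimality*, Algebra & Number
  Theory 12 (2018), Prop. 3.22, Prop. 3.24.
* M. Bays, B. Zilber, *Covers of multiplicative groups of algebraically closed fields of arbitrary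
  characteristic*, Bull. LMS 43 (2011), Thm 2.3, Prop. 2.5, Lemma 5.1.
* J. Kirby, *Finitely presented exponential fields*, Algebra & Number Theory 7 (2013), Fact 3.7.
-/

noncomputable section

open Set

namespace Literature.FieldTheory.Kummer

namespace DivisionSequencesProofs

universe u

/-! ### Kernel equality from independence modulo all powers -/

section KernelEq

variable {L : Type*} [Field L] {n : ℕ}

/-- Substituting `X_{(m,j)} ↦ X_j^{N/m}` computes a relation of a division system at level `N`
(for `m ∣ N`, `ρ_m = ρ_N^{N/m}`). [folklore] -/
theorem aeval_divisionSystem_eq {Ω₁ : Type*} [Field Ω₁] [Algebra L Ω₁] (c' : Fin n → L)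
    (ρ : ℕ+ → Fin n → Ω₁) (hρ : IsDivisionSystem (fun j => algebraMap L Ω₁ (c' j)) ρ)
    (P : MvPolynomial (ℕ+ × Fin n) L) (N : ℕ+) (hN : ∀ p ∈ P.vars, p.1 ∣ N) :
    MvPolynomial.aeval (fun p : ℕ+ × Fin n => ρ p.1 p.2) P =
      MvPolynomial.aeval (ρ N) (MvPolynomial.aeval
        (fun p : ℕ+ × Fin n => (MvPolynomial.X p.2 : MvPolynomial (Fin n) L) ^ ((N : ℕ) / (p.1 : ℕ)))
          P) := by
  rw [← AlgHom.comp_apply]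
  change ((MvPolynomial.aeval fun p : ℕ+ × Fin n => ρ p.1 p.2 : _ →ₐ[L] Ω₁) : _ →+* Ω₁) P =
    (((MvPolynomial.aeval (ρ N)).comp (MvPolynomial.aeval fun p : ℕ+ × Fin n =>
      (MvPolynomial.X p.2 : MvPolynomial (Fin n) L) ^ ((N : ℕ) / (p.1 : ℕ))) : _ →ₐ[L] Ω₁) :
        _ →+* Ω₁) P
  refine MvPolynomial.hom_congr_vars ?_ (fun p hp _ => ?_) rfl
  · ext x
    simp
  · obtain ⟨k, hk⟩ := hN p hp
    change MvPolynomial.aeval (fun p : ℕ+ × Fin n => ρ p.1 p.2) (MvPolynomial.X p) =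
      MvPolynomial.aeval (ρ N) (MvPolynomial.aeval (fun p : ℕ+ × Fin n =>
        (MvPolynomial.X p.2 : MvPolynomial (Fin n) L) ^ ((N : ℕ) / (p.1 : ℕ))) (MvPolynomial.X p))
    rw [MvPolynomial.aeval_X, MvPolynomial.aeval_X, map_pow, MvPolynomial.aeval_X, hk, PNat.mul_coe,
      Nat.mul_div_cancel_left _ p.1.pos]
    exact (hρ.2 p.1 k p.2).symm

/-- **One level.** If `c'` is independent modulo `N`-th powers in `L` (`L ∋ ζ_N, √-1`), the ideal
of relations over `L` of any tuple of `N`-th roots of `c'` in any field is the Kummer ideal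
`(X_jᴺ - c'_j)`. [cite: Lang2002, VI §8 Thm 8.1] -/
theorem ker_aeval_level_eq (c' : Fin n → L) (hc : ∀ j, c' j ≠ 0) {N : ℕ} [NeZero N] {ζ : L}
    (hζ : IsPrimitiveRoot ζ N) (hi : ∃ i : L, i ^ 2 = -1) (hind : IndepModPowers N c')
    {Ω₁ : Type*} [Field Ω₁] [Algebra L Ω₁] (y : Fin n → Ω₁)
    (hy : ∀ j, y j ^ N = algebraMap L Ω₁ (c' j)) :
    RingHom.ker (MvPolynomial.aeval y : MvPolynomial (Fin n) L →ₐ[L] Ω₁) = kummerIdeal N c' := by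
  have hmax := isMaximal_kummerIdeal hζ hi c' hc hind
  symm
  refine hmax.eq_of_le (RingHom.ker_ne_top _) ?_
  refine Ideal.span_le.2 ?_
  rintro _ ⟨j, rfl⟩
  rw [SetLike.mem_coe, RingHom.mem_ker, map_sub, map_pow, MvPolynomial.aeval_X, MvPolynomial.aeval_C,
    hy, sub_self]

/-- **Kernel equality.** If `c' ∈ (Lˣ)ⁿ` is independent modulo `N`-th powers in `L` for every
`N ≥ 1`, and `L` contains all roots of unity (primitive ones of each order) and `√-1`, then any
two division systems below `c'`, in arbitrary field extensions of `L`, satisfy the same polynomial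
relations over `L`. [cite: BaysKirby2018ANT, Prop. 3.22 (proof)] -/
theorem ker_aeval_divisionSystem_eq (c' : Fin n → L) (hc : ∀ j, c' j ≠ 0)
    (hζ : ∀ N : ℕ, 0 < N → ∃ ζ : L, IsPrimitiveRoot ζ N) (hi : ∃ i : L, i ^ 2 = -1)
    (hind : ∀ N : ℕ, 0 < N → IndepModPowers N c')
    {Ω₁ Ω₂ : Type*} [Field Ω₁] [Field Ω₂] [Algebra L Ω₁] [Algebra L Ω₂]
    (ρ : ℕ+ → Fin n → Ω₁) (hρ : IsDivisionSystem (fun j => algebraMap L Ω₁ (c' j)) ρ)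
    (σ : ℕ+ → Fin n → Ω₂) (hσ : IsDivisionSystem (fun j => algebraMap L Ω₂ (c' j)) σ) :
    RingHom.ker (MvPolynomial.aeval (fun p : ℕ+ × Fin n => ρ p.1 p.2) :
        MvPolynomial (ℕ+ × Fin n) L →ₐ[L] Ω₁) =
      RingHom.ker (MvPolynomial.aeval (fun p : ℕ+ × Fin n => σ p.1 p.2) :
        MvPolynomial (ℕ+ × Fin n) L →ₐ[L] Ω₂) := by
  classical
  ext P
  set N : ℕ+ := ∏ p ∈ P.vars, p.1 with hNdef
  have hN : ∀ p ∈ P.vars, p.1 ∣ N := fun p hp => Finset.dvd_prod_of_mem (fun q : ℕ+ × Fin n => q.1) hp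
  haveI : NeZero ((N : ℕ)) := ⟨N.ne_zero⟩
  obtain ⟨ζ, hζN⟩ := hζ N N.pos
  have hρN : ∀ j, ρ N j ^ (N : ℕ) = algebraMap L Ω₁ (c' j) := fun j => hρ.pow_eq N j
  have hσN : ∀ j, σ N j ^ (N : ℕ) = algebraMap L Ω₂ (c' j) := fun j => hσ.pow_eq N j
  rw [RingHom.mem_ker, RingHom.mem_ker, aeval_divisionSystem_eq c' ρ hρ P N hN,
    aeval_divisionSystem_eq c' σ hσ P N hN, ← RingHom.mem_ker, ← RingHom.mem_ker,
    ker_aeval_level_eq c' hc hζN hi (hind N N.pos) (ρ N) hρN,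
    ker_aeval_level_eq c' hc hζN hi (hind N N.pos) (σ N) hσN]

/-- **Transport of relations along field embeddings**: for `θ : L → L'`, `ι : Ω → Ω'` compatible
with the structure maps, `P(g) = 0 ↔ (θP)(ι ∘ g) = 0`. [folklore] -/
theorem aeval_eq_zero_iff_of_ringHom {L' Ω Ω' : Type*} [Field L'] [Field Ω] [Field Ω']
    [Algebra L Ω] [Algebra L' Ω'] (θ : L →+* L') (ι : Ω →+* Ω')
    (hcomm : ι.comp (algebraMap L Ω) = (algebraMap L' Ω').comp θ) {τ : Type*} (g : τ → Ω)
    (P : MvPolynomial τ L) :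
    MvPolynomial.aeval g P = 0 ↔
      MvPolynomial.aeval (fun t => ι (g t)) (MvPolynomial.map θ P) = 0 := by
  rw [← map_eq_zero_iff ι ι.injective, MvPolynomial.map_aeval, hcomm, MvPolynomial.aeval_def,
    MvPolynomial.eval₂_map, MvPolynomial.coe_eval₂Hom]

end KernelEq

/-! ### Kummer independence of good division points (the Goal) -/

section Goal

variable {Ω : Type u} [Field Ω]

/-- `(∏ c'ⱼ^{uⱼ})ᵐ = ∏ cⱼ^{uⱼ}` when `c'ⱼᵐ = cⱼ`. [folklore] -/
theorem prod_zpow_pow_eq {n : ℕ} {c' c : Fin n → Ω} {m : ℕ} (h : ∀ j, c' j ^ m = c j)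
    (u : Fin n → ℤ) : (∏ j, c' j ^ u j) ^ m = ∏ j, c j ^ u j := by
  rw [← Finset.prod_pow]
  refine Finset.prod_congr rfl fun j _ => ?_
  rw [← zpow_natCast, ← zpow_mul, mul_comm, zpow_mul, zpow_natCast, h j]

variable [CharZero Ω] [IsAlgClosed Ω]

/-- A primitive `N`-th root of unity exists in an algebraically closed field of characteristic
`0`. [folklore] -/
theorem exists_isPrimitiveRoot {N : ℕ} (hN : 0 < N) : ∃ ζ : Ω, IsPrimitiveRoot ζ N := by
  haveI : NeZero N := ⟨hN.ne'⟩
  haveI : NeZero ((N : ℕ) : Ω) := NeZero.charZero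
  exact HasEnoughRootsOfUnity.prim

/-- **Kummer independence of good division points** (Bays–Kirby 2018, Prop. 3.22 "existence of
good bases", Case (EXP), with its proof and Prop. 3.24; Bays–Zilber 2011, proof of Thm 2.3): for
`Ω` algebraically closed of characteristic `0`, `S` finite, `(b, c)` multiplicatively independent
modulo roots of unity, there is `m ≥ 1` such that for every tuple `c'` of `m`-th roots of `c`,
the tuple `c'` is independent modulo `k`-th powers in `L = ℚ(μ, S, c', √b)` for every `k ≥ 1`.
[cite: BaysKirby2018ANT, Prop. 3.22 (with its proof, Case (EXP)) and Prop. 3.24] -/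
theorem indepModPowers_baseTuple (S : Set Ω) (hS : S.Finite) {r n : ℕ} (b : Fin r → Ω)
    (c : Fin n → Ω) (hb : ∀ i, b i ≠ 0) (hc : ∀ j, c j ≠ 0)
    (hind : MulIndepModTorsion (Fin.append b c)) :
    ∃ m : ℕ, 0 < m ∧ ∀ c' : Fin n → Ω, (∀ j, c' j ^ m = c j) →
      ∀ k : ℕ, 0 < k → IndepModPowers k (fun j => baseTuple S b c' j) := by
  classical
  -- `K = ℚ(μ)(S, b, c)` and the denominator bound `m₀`
  let G : Finset Ω := hS.toFinset ∪ Finset.univ.image b ∪ Finset.univ.image c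
  set K : Subfield Ω := Subfield.closure (allRoots (1 : Ω) ∪ (G : Set Ω)) with hK
  have hGS : ∀ x ∈ S, x ∈ (G : Set Ω) := fun x hx => by
    simp only [G, Finset.coe_union, Set.mem_union, Finset.mem_coe, Set.Finite.mem_toFinset]
    exact Or.inl (Or.inl hx)
  have hGb : ∀ i, b i ∈ (G : Set Ω) := fun i => by
    simp only [G, Finset.coe_union, Set.mem_union, Finset.mem_coe, Finset.mem_image,
      Finset.mem_univ, true_and]
    exact Or.inl (Or.inr ⟨i, rfl⟩)
  have hGc : ∀ j, c j ∈ (G : Set Ω) := fun j => by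
    simp only [G, Finset.coe_union, Set.mem_union, Finset.mem_coe, Finset.mem_image,
      Finset.mem_univ, true_and]
    exact Or.inr ⟨j, rfl⟩
  have hμK : ∀ m : ℕ, 0 < m → ∀ θ : Ω, θ ^ m = 1 → θ ∈ K := fun m hm θ hθ =>
    Subfield.subset_closure (Or.inl ⟨m, hm, hθ⟩)
  have hbK : ∀ i, b i ∈ K := fun i => Subfield.subset_closure (Or.inr (hGb i))
  have hcK : ∀ j, c j ∈ K := fun j => Subfield.subset_closure (Or.inr (hGc j))
  have hSK : ∀ x ∈ S, x ∈ K := fun x hx => Subfield.subset_closure (Or.inr (hGS x hx))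
  have hvK : ∀ l, Fin.append b c l ∈ K := fun l => by
    refine Fin.addCases (fun i => ?_) (fun j => ?_) l
    · rw [Fin.append_left]; exact hbK i
    · rw [Fin.append_right]; exact hcK j
  have hv0 : ∀ l, Fin.append b c l ≠ 0 := fun l => by
    refine Fin.addCases (fun i => ?_) (fun j => ?_) l
    · rw [Fin.append_left]; exact hb i
    · rw [Fin.append_right]; exact hc j
  obtain ⟨m₀, hm₀, hK2⟩ := RadicalBoundFG.exists_dvd_of_mem_closure_fg G (Fin.append b c) hvK hv0 hind
  refine ⟨m₀, hm₀, fun c' hc' k hk uu hxex j₀ => ?_⟩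
  set L : Subfield Ω := baseField (S ∪ Set.range c') b with hL
  obtain ⟨x, hx⟩ := hxex
  have hc'0 : ∀ j, c' j ≠ 0 := fun j h => hc j (by rw [← hc' j, h, zero_pow hm₀.ne'])
  -- the relation in `Ω`
  have hxΩ : (x : Ω) ^ k = ∏ j, c' j ^ uu j := by
    have := congrArg (L.subtype) hx
    rw [map_pow, map_prod] at this
    rw [show (x : Ω) = L.subtype x from rfl, this]
    exact Finset.prod_congr rfl fun j _ => by rw [map_zpow₀]; rfl
  have hx0 : (x : Ω) ≠ 0 := by
    intro h
    have : (x : Ω) ^ k = 0 := by rw [h, zero_pow hk.ne']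
    rw [hxΩ] at this
    exact Finset.prod_ne_zero_iff.2 (fun j _ => zpow_ne_zero _ (hc'0 j)) this
  -- Step 1: over `M = ℚ(μ, S, b^ℚ, c)`, `x = e ∏ c'ⱼ^{vvⱼ}` with `e ∈ M`
  set M : Subfield Ω :=
    Subfield.closure (allRoots (1 : Ω) ∪ S ∪ (⋃ i, allRoots (b i)) ∪ Set.range c) with hM
  have hμM : ∀ m : ℕ, 0 < m → ∀ θ : Ω, θ ^ m = 1 → θ ∈ M := fun m hm θ hθ =>
    Subfield.subset_closure (Or.inl (Or.inl (Or.inl ⟨m, hm, hθ⟩)))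
  have hcM : ∀ j, c j ∈ M := fun j => Subfield.subset_closure (Or.inr ⟨j, rfl⟩)
  obtain ⟨ζ₀, hζ₀⟩ := exists_isPrimitiveRoot (Ω := Ω) hm₀
  have hζ₀M : ζ₀ ∈ M := hμM m₀ hm₀ ζ₀ hζ₀.pow_eq_one
  have hxclosM : (x : Ω) ∈ Subfield.closure ((M : Set Ω) ∪ Set.range c') := by
    have hLle : L ≤ Subfield.closure ((M : Set Ω) ∪ Set.range c') := by
      rw [hL, baseField]
      refine Subfield.closure_le.2 ?_
      rintro y ((hy | (hy | hy)) | hy)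
      · exact Subfield.subset_closure (Or.inl (Subfield.subset_closure (Or.inl (Or.inl (Or.inl hy)))))
      · exact Subfield.subset_closure (Or.inl (Subfield.subset_closure (Or.inl (Or.inl (Or.inr hy)))))
      · exact Subfield.subset_closure (Or.inr hy)
      · exact Subfield.subset_closure (Or.inl (Subfield.subset_closure (Or.inl (Or.inr hy))))
    exact hLle x.2
  have hxM : (x : Ω) ^ (k * m₀) ∈ M := by
    rw [pow_mul, hxΩ, prod_zpow_pow_eq hc']
    exact prod_mem fun j _ => zpow_mem (hcM j) _
  obtain ⟨e, heM, vv, hxe⟩ := KummerRadicals.exists_eq_mul_prod_pow M hμM hm₀ hζ₀ hζ₀M n c' hc'0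
    (fun j => by rw [hc' j]; exact hcM j) (x : Ω) hxclosM (k * m₀) (Nat.mul_pos hk hm₀) hxM
  -- Step 2: `e ∈ K(β)` for `N`-th roots `βᵢ` of the `bᵢ`, and `e = e' ∏ βᵢ^{wwᵢ}`, `e' ∈ K`
  let R : ℕ+ → Subfield Ω := fun N =>
    Subfield.closure ((K : Set Ω) ∪ {y | ∃ i, y ^ (N : ℕ) = b i})
  have hRdir : Directed (· ≤ ·) R := by
    intro N₁ N₂
    refine ⟨N₁ * N₂, ?_, ?_⟩
    · refine Subfield.closure_le.2 ?_
      rintro y (hy | ⟨i, hy⟩)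
      · exact Subfield.subset_closure (Or.inl hy)
      · obtain ⟨w, hw⟩ := IsAlgClosed.exists_pow_nat_eq y N₂.pos
        have hwR : w ∈ R (N₁ * N₂) := Subfield.subset_closure (Or.inr ⟨i, by
          rw [PNat.mul_coe, mul_comm, pow_mul, hw, hy]⟩)
        rw [← hw]
        exact pow_mem hwR _
    · refine Subfield.closure_le.2 ?_
      rintro y (hy | ⟨i, hy⟩)
      · exact Subfield.subset_closure (Or.inl hy)
      · obtain ⟨w, hw⟩ := IsAlgClosed.exists_pow_nat_eq y N₁.pos
        have hwR : w ∈ R (N₁ * N₂) := Subfield.subset_closure (Or.inr ⟨i, by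
          rw [PNat.mul_coe, pow_mul, hw, hy]⟩)
        rw [← hw]
        exact pow_mem hwR _
  have hMle : M ≤ ⨆ N, R N := by
    rw [hM]
    refine Subfield.closure_le.2 ?_
    rintro y (((hy | hy) | hy) | hy)
    · exact (le_iSup R 1) (Subfield.subset_closure (Or.inl (Subfield.subset_closure (Or.inl hy))))
    · exact (le_iSup R 1) (Subfield.subset_closure (Or.inl (hSK y hy)))
    · obtain ⟨i, hyi⟩ := Set.mem_iUnion.1 hy
      obtain ⟨kk, hkk, hykk⟩ := hyi
      exact (le_iSup R ⟨kk, hkk⟩) (Subfield.subset_closure (Or.inr ⟨i, hykk⟩))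
    · obtain ⟨j, rfl⟩ := hy
      exact (le_iSup R 1) (Subfield.subset_closure (Or.inl (hcK j)))
  obtain ⟨N, heN⟩ := (Subfield.mem_iSup_of_directed hRdir).1 (hMle heM)
  have hβex : ∀ i, ∃ β : Ω, β ^ (N : ℕ) = b i := fun i => IsAlgClosed.exists_pow_nat_eq _ N.pos
  choose β hβ using hβex
  have hβ0 : ∀ i, β i ≠ 0 := fun i h => hb i (by rw [← hβ i, h, zero_pow N.ne_zero])
  have heclosK : e ∈ Subfield.closure ((K : Set Ω) ∪ Set.range β) := by
    have hle : R N ≤ Subfield.closure ((K : Set Ω) ∪ Set.range β) := by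
      refine Subfield.closure_le.2 ?_
      rintro y (hy | ⟨i, hy⟩)
      · exact Subfield.subset_closure (Or.inl hy)
      · -- `y = (y/βᵢ) βᵢ` with `y/βᵢ` a root of unity
        have hroot : (y * (β i)⁻¹) ^ (N : ℕ) = 1 := by
          rw [mul_pow, inv_pow, hy, hβ i, mul_inv_cancel₀ (hb i)]
        have h1 : y * (β i)⁻¹ ∈ K := hμK N N.pos _ hroot
        have : y = y * (β i)⁻¹ * β i := by rw [inv_mul_cancel_right₀ (hβ0 i)]
        rw [this]
        exact mul_mem (Subfield.subset_closure (Or.inl h1)) (Subfield.subset_closure (Or.inr ⟨i, rfl⟩))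
    exact hle heN
  obtain ⟨ζN, hζN⟩ := exists_isPrimitiveRoot (Ω := Ω) N.pos
  have hprodc'0 : (∏ j, c' j ^ (vv j : ℤ)) ≠ 0 :=
    Finset.prod_ne_zero_iff.2 fun j _ => zpow_ne_zero _ (hc'0 j)
  have hxe' : (x : Ω) = e * ∏ j, c' j ^ (vv j : ℤ) := by
    rw [hxe]; simp only [zpow_natCast]
  have heeq : e = (x : Ω) * (∏ j, c' j ^ (vv j : ℤ))⁻¹ := by
    rw [hxe', mul_inv_cancel_right₀ hprodc'0]
  have heK : e ^ (k * m₀) ∈ K := by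
    rw [heeq, mul_pow, inv_pow, pow_mul, hxΩ, prod_zpow_pow_eq hc', mul_comm k m₀, pow_mul,
      prod_zpow_pow_eq hc']
    refine mul_mem (prod_mem fun j _ => zpow_mem (hcK j) _) (inv_mem (pow_mem ?_ _))
    exact prod_mem fun j _ => zpow_mem (hcK j) _
  obtain ⟨e', he'K, ww, hee'⟩ := KummerRadicals.exists_eq_mul_prod_pow K hμK N.pos hζN
    (hμK N N.pos ζN hζN.pow_eq_one) r β hβ0 (fun i => by rw [hβ i]; exact hbK i) e heclosK
    (k * m₀) (Nat.mul_pos hk hm₀) heK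
  -- Step 3: the relation for `e'` and the denominator bound
  have hprodβ0 : (∏ i, β i ^ (ww i : ℤ)) ≠ 0 :=
    Finset.prod_ne_zero_iff.2 fun i _ => zpow_ne_zero _ (hβ0 i)
  have he'eq : e' = (x : Ω) * (∏ j, c' j ^ (vv j : ℤ))⁻¹ * (∏ i, β i ^ (ww i : ℤ))⁻¹ := by
    have : e = e' * ∏ i, β i ^ (ww i : ℤ) := by rw [hee']; simp only [zpow_natCast]
    rw [← heeq, this, mul_inv_cancel_right₀ hprodβ0]
  set P : ℕ := k * m₀ * N with hP
  have hrelP : e' ^ P = (∏ l, Fin.append b c l ^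
      Fin.append (fun i => -(((k * m₀ : ℕ) : ℤ) * ww i)) (fun j => (N : ℤ) * (uu j - k * vv j)) l) * 1 := by
    rw [mul_one, Fin.prod_univ_add]
    simp only [Fin.append_left, Fin.append_right]
    -- compute the three factors
    have h1 : (x : Ω) ^ P = ∏ j, c j ^ ((N : ℤ) * uu j) := by
      rw [hP, pow_mul, pow_mul, hxΩ, prod_zpow_pow_eq hc', ← zpow_natCast,
        ← RadicalBoundFG.prod_zpow_int_mul]
    have h2 : (∏ j, c' j ^ (vv j : ℤ)) ^ P = ∏ j, c j ^ (((k * N : ℕ) : ℤ) * vv j) := by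
      rw [hP, show k * m₀ * (N : ℕ) = m₀ * (k * N) by ring, pow_mul, prod_zpow_pow_eq hc',
        ← zpow_natCast, ← RadicalBoundFG.prod_zpow_int_mul]
    have h3 : (∏ i, β i ^ (ww i : ℤ)) ^ P = ∏ i, b i ^ (((k * m₀ : ℕ) : ℤ) * ww i) := by
      rw [hP, mul_comm (k * m₀) (N : ℕ), pow_mul, prod_zpow_pow_eq hβ, ← zpow_natCast,
        ← RadicalBoundFG.prod_zpow_int_mul]
    rw [he'eq, mul_pow, mul_pow, inv_pow, inv_pow, h1, h2, h3]
    -- rearrange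
    have h4 : (∏ i, b i ^ (-(((k * m₀ : ℕ) : ℤ) * ww i))) = (∏ i, b i ^ (((k * m₀ : ℕ) : ℤ) * ww i))⁻¹ := by
      rw [← Finset.prod_inv_distrib]
      exact Finset.prod_congr rfl fun i _ => by rw [← zpow_neg]
    have h5 : (∏ j, c j ^ ((N : ℤ) * (uu j - k * vv j))) =
        (∏ j, c j ^ ((N : ℤ) * uu j)) * (∏ j, c j ^ (((k * N : ℕ) : ℤ) * vv j))⁻¹ := by
      rw [← Finset.prod_inv_distrib, ← Finset.prod_mul_distrib]
      refine Finset.prod_congr rfl fun j _ => ?_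
      rw [← zpow_neg, ← zpow_add₀ (hc j)]
      congr 1
      push_cast
      ring
    rw [h4, h5]
    ring
  have hdvd := hK2 e' he'K P _ 1 (one_mem_allRoots_one) hrelP (Fin.natAdd r j₀)
  simp only [Fin.append_right] at hdvd
  -- `k m₀ N ∣ m₀ N (uu - k vv)` gives `k ∣ uu`
  have h1 : ((k : ℤ) * (m₀ * N)) ∣ (uu j₀ - k * vv j₀) * (m₀ * N) := by
    have : (m₀ : ℤ) * ((N : ℤ) * (uu j₀ - k * vv j₀)) = (uu j₀ - k * vv j₀) * (m₀ * N) := by ring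
    rw [← this]
    have hP' : ((P : ℕ) : ℤ) = (k : ℤ) * (m₀ * N) := by rw [hP]; push_cast; ring
    rw [← hP']
    exact hdvd
  have hne : (m₀ : ℤ) * N ≠ 0 := mul_ne_zero (by exact_mod_cast hm₀.ne') (by exact_mod_cast N.ne_zero)
  have h2 : (k : ℤ) ∣ uu j₀ - k * vv j₀ := (mul_dvd_mul_iff_right hne).1 h1
  have h3 : uu j₀ = (uu j₀ - k * vv j₀) + k * vv j₀ := by ring
  rw [h3]
  exact dvd_add h2 (Dvd.intro _ rfl)

end Goal

/-! ### The reduction to algebraically closed `Ω` and the proof of the fact -/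

section Final

variable {Ω : Type u} [Field Ω]

/-- Generators of the base field map into the generators over the algebraic closure. [folklore] -/
theorem map_baseField_le {Ω' : Type u} [Field Ω'] (ι : Ω →+* Ω') (S : Set Ω) {r n : ℕ}
    (b : Fin r → Ω) (c' : Fin n → Ω) :
    (baseField (S ∪ Set.range c') b).map ι ≤
      baseField (ι '' S ∪ Set.range (fun j => ι (c' j))) (fun i => ι (b i)) := by
  rw [baseField, RingHom.map_field_closure, baseField]
  refine Subfield.closure_mono ?_
  rintro _ ⟨y, ((hy | (hy | ⟨j, rfl⟩)) | hy), rfl⟩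
  · obtain ⟨k, hk, hyk⟩ := hy
    exact Or.inl (Or.inl ⟨k, hk, by rw [← map_pow, hyk, map_one]⟩)
  · exact Or.inl (Or.inr (Or.inl ⟨y, hy, rfl⟩))
  · exact Or.inl (Or.inr (Or.inr ⟨j, rfl⟩))
  · obtain ⟨i, hyi⟩ := Set.mem_iUnion.1 hy
    obtain ⟨k, hk, hyk⟩ := hyi
    exact Or.inr (Set.mem_iUnion.2 ⟨i, k, hk, by rw [← map_pow, hyk]⟩)

end Final

end DivisionSequencesProofs

universe u

open DivisionSequencesProofs in
/-- **Division sequences below a good division point are determined** (Bays–Kirby 2018,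
Prop. 3.22 with its proof (Case (EXP)) and Prop. 3.24; Kirby 2013, Fact 3.7; Bays–Zilber 2011,
Thm 2.3): discharge of the named fact `BaysKirby2018_divisionSequences_determined`.
[cite: BaysKirby2018ANT, Prop. 3.22 (with its proof, Case (EXP)) and Prop. 3.24]
[cite: BaysZilber2011Covers, Thm 2.3, Prop. 2.5, Lemma 5.1] -/
theorem BaysKirby2018_divisionSequences_determined_holds :
    BaysKirby2018_divisionSequences_determined.{u} := by
  intro Ω _ _ S hS r n b c hb hc hind
  classical
  -- pass to the algebraic closure `Ω'`
  let Ω' := AlgebraicClosure Ω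
  let ι : Ω →+* Ω' := algebraMap Ω Ω'
  have hι : Function.Injective ι := (algebraMap Ω Ω').injective
  have hb' : ∀ i, ι (b i) ≠ 0 := fun i => (map_ne_zero_iff ι hι).2 (hb i)
  have hc'0 : ∀ j, ι (c j) ≠ 0 := fun j => (map_ne_zero_iff ι hι).2 (hc j)
  have happ : ∀ l, Fin.append (fun i => ι (b i)) (fun j => ι (c j)) l = ι (Fin.append b c l) := by
    intro l
    refine Fin.addCases (fun i => ?_) (fun j => ?_) l
    · rw [Fin.append_left, Fin.append_left]
    · rw [Fin.append_right, Fin.append_right]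
  have hind' : MulIndepModTorsion (Fin.append (fun i => ι (b i)) (fun j => ι (c j))) := by
    intro w hw
    apply hind w
    obtain ⟨k, hk, hwk⟩ := hw
    refine ⟨k, hk, hι ?_⟩
    rw [map_pow, map_one, map_prod, ← hwk]
    congr 1
    exact Finset.prod_congr rfl fun l _ => by rw [map_zpow₀, happ]
  obtain ⟨m, hm, hmain⟩ := indepModPowers_baseTuple (Ω := Ω') (ι '' S) (hS.image ι)
    (fun i => ι (b i)) (fun j => ι (c j)) hb' hc'0 hind'
  refine ⟨m, hm, ?_⟩
  intro c' hc' ρ hρ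
  -- the base fields `L ⊆ Ω` and `L' ⊆ Ω'` and `θ : L → L'`
  set L : Subfield Ω := baseField (S ∪ Set.range c') b with hL
  intro Ω₂ _ _ σ hσ
  set L' : Subfield Ω' := baseField (ι '' S ∪ Set.range (fun j => ι (c' j))) (fun i => ι (b i))
    with hL'
  have hLL' : ∀ x : L, ι x ∈ L' := fun x =>
    map_baseField_le ι S b c' (Subfield.mem_map.2 ⟨x, x.2, rfl⟩)
  let θ : L →+* L' := (ι.comp L.subtype).codRestrict L' hLL'
  have hθ : ∀ x : L, ((θ x : L') : Ω') = ι x := fun x => rfl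
  have hθc : ∀ j, θ (baseTuple S b c' j) =
      baseTuple (ι '' S) (fun i => ι (b i)) (fun j => ι (c' j)) j := fun j => Subtype.ext rfl
  -- hypotheses of the kernel-equality theorem for `L'`
  have hcL' : ∀ j, baseTuple (ι '' S) (fun i => ι (b i)) (fun j => ι (c' j)) j ≠ 0 := by
    intro j h
    have h1 : ι (c' j) = 0 := congrArg Subtype.val h
    have h2 : c' j = 0 := hι (by rw [h1, map_zero])
    apply hc j
    rw [← hc' j, h2, zero_pow hm.ne']
  have hμL' : ∀ (N : ℕ), 0 < N → ∀ t : Ω', t ^ N = 1 → t ∈ L' := fun N hN t ht =>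
    mem_baseField_of_mem_allRoots_one _ ⟨N, hN, ht⟩
  have hζL' : ∀ N : ℕ, 0 < N → ∃ ζ : L', IsPrimitiveRoot ζ N := by
    intro N hN
    obtain ⟨ζ, hζ⟩ := exists_isPrimitiveRoot (Ω := Ω') hN
    refine ⟨⟨ζ, hμL' N hN ζ hζ.pow_eq_one⟩, ?_⟩
    exact IsPrimitiveRoot.of_map_of_injective (f := L'.subtype) (by exact hζ) L'.subtype.injective
  have hiL' : ∃ i : L', i ^ 2 = -1 := by
    obtain ⟨ζ, hζ⟩ := exists_isPrimitiveRoot (Ω := Ω') (show 0 < 4 by norm_num)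
    have h2 : IsPrimitiveRoot (ζ ^ 2) 2 := hζ.pow (show 0 < 4 by norm_num) (by norm_num)
    have h3 : ζ ^ 2 = -1 := h2.eq_neg_one_of_two_right
    refine ⟨⟨ζ, hμL' 4 (by norm_num) ζ hζ.pow_eq_one⟩, Subtype.ext ?_⟩
    simpa using h3
  have hindL' : ∀ N : ℕ, 0 < N →
      IndepModPowers N (fun j => baseTuple (ι '' S) (fun i => ι (b i)) (fun j => ι (c' j)) j) :=
    fun N hN => hmain (fun j => ι (c' j)) (fun j => by rw [← map_pow, hc' j]) N hN
  -- `ρ` in `Ω'`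
  let ρ' : ℕ+ → Fin n → Ω' := fun p j => ι (ρ p j)
  have hρ' : IsDivisionSystem
      (fun j => algebraMap L' Ω' (baseTuple (ι '' S) (fun i => ι (b i)) (fun j => ι (c' j)) j)) ρ' := by
    refine ⟨funext fun j => ?_, fun p q j => ?_⟩
    · change ι (ρ 1 j) = ι (c' j)
      exact congrArg ι (congrFun hρ.1 j)
    · change ι (ρ (p * q) j) ^ (q : ℕ) = ι (ρ p j)
      rw [← map_pow, hρ.2 p q j]
  -- `σ` in the algebraic closure of `Ω₂`, an `L'`-algebra via `IsAlgClosed.lift`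
  let Ω₂' := AlgebraicClosure Ω₂
  let ι₂ : Ω₂ →+* Ω₂' := algebraMap Ω₂ Ω₂'
  letI algLL' : Algebra L L' := θ.toAlgebra
  haveI : Algebra.IsAlgebraic L L' := by
    refine ⟨fun y => ?_⟩
    -- every element of `L'` is integral over `L`: induction on the generating set
    suffices h : ∀ (z : Ω') (hz : z ∈ L'), IsIntegral L (⟨z, hz⟩ : L') from
      (h y y.2).isAlgebraic
    intro z hz
    refine Subfield.closure_induction (p := fun w hw => IsIntegral L (⟨w, hw⟩ : L'))
      ?_ ?_ ?_ ?_ ?_ ?_ hz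
    · rintro w ((hw | (hw | hw)) | hw)
      · obtain ⟨k, hk, hwk⟩ := hw
        refine IsIntegral.of_pow hk ?_
        have h1 : (⟨w, Subfield.subset_closure (Or.inl (Or.inl ⟨k, hk, hwk⟩))⟩ : L') ^ k = 1 :=
          Subtype.ext (by rw [SubmonoidClass.coe_pow, OneMemClass.coe_one]; exact hwk)
        rw [h1]
        exact isIntegral_one
      · obtain ⟨t, ht, rfl⟩ := hw
        have h1 : (⟨ι t, Subfield.subset_closure (Or.inl (Or.inr (Or.inl ⟨t, ht, rfl⟩)))⟩ : L') =
            algebraMap L L' ⟨t, mem_baseField_of_mem b (Or.inl ht)⟩ := Subtype.ext rfl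
        rw [h1]
        exact isIntegral_algebraMap
      · obtain ⟨j, rfl⟩ := hw
        have h1 : (⟨ι (c' j), Subfield.subset_closure (Or.inl (Or.inr (Or.inr ⟨j, rfl⟩)))⟩ : L') =
            algebraMap L L' (baseTuple S b c' j) := Subtype.ext rfl
        rw [h1]
        exact isIntegral_algebraMap
      · obtain ⟨i, hwi⟩ := Set.mem_iUnion.1 hw
        obtain ⟨k, hk, hwk⟩ := hwi
        refine IsIntegral.of_pow hk ?_
        have h1 : (⟨w, Subfield.subset_closure (Or.inr hw)⟩ : L') ^ k =
            algebraMap L L' ⟨b i, mem_baseField_of_mem_allRoots b i (self_mem_allRoots _)⟩ :=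
          Subtype.ext (by rw [SubmonoidClass.coe_pow]; exact hwk)
        rw [h1]
        exact isIntegral_algebraMap
    · exact isIntegral_one
    · intro x y hx hy hx' hy'
      exact hx'.add hy'
    · intro x hx hx'
      exact hx'.neg
    · intro x hx hx'
      exact hx'.inv
    · intro x y hx hy hx' hy'
      exact hx'.mul hy'
  let ψ : L' →ₐ[L] Ω₂' := IsAlgClosed.lift
  letI algL'Ω₂' : Algebra L' Ω₂' := ψ.toRingHom.toAlgebra
  let σ' : ℕ+ → Fin n → Ω₂' := fun p j => ι₂ (σ p j)
  have hψθ : ∀ x : L, ψ (θ x) = ι₂ (algebraMap L Ω₂ x) := fun x => by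
    have h := ψ.commutes x
    rw [IsScalarTower.algebraMap_apply L Ω₂ Ω₂' x] at h
    exact h
  have hσ' : IsDivisionSystem
      (fun j => algebraMap L' Ω₂' (baseTuple (ι '' S) (fun i => ι (b i)) (fun j => ι (c' j)) j)) σ' := by
    have hcj : ∀ j, algebraMap L' Ω₂' (baseTuple (ι '' S) (fun i => ι (b i)) (fun j => ι (c' j)) j) =
        ι₂ (algebraMap L Ω₂ (baseTuple S b c' j)) := fun j => by
      rw [← hθc, ← hψθ]; rfl
    refine ⟨funext fun j => ?_, fun p q j => ?_⟩
    · rw [hcj]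
      change ι₂ (σ 1 j) = _
      exact congrArg ι₂ (congrFun hσ.1 j)
    · change ι₂ (σ (p * q) j) ^ (q : ℕ) = ι₂ (σ p j)
      rw [← map_pow, hσ.2 p q j]
  have hker' := ker_aeval_divisionSystem_eq _ hcL' hζL' hiL' hindL' ρ' hρ' σ' hσ'
  -- transport back to `L`
  have hcomm₁ : ι.comp (algebraMap L Ω) = (algebraMap L' Ω').comp θ := RingHom.ext fun x => rfl
  have hcomm₂ : ι₂.comp (algebraMap L Ω₂) = (algebraMap L' Ω₂').comp θ :=
    RingHom.ext fun x => (hψθ x).symm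
  ext P
  rw [RingHom.mem_ker, RingHom.mem_ker,
    aeval_eq_zero_iff_of_ringHom θ ι hcomm₁ (fun p : ℕ+ × Fin n => ρ p.1 p.2) P,
    aeval_eq_zero_iff_of_ringHom θ ι₂ hcomm₂ (fun p : ℕ+ × Fin n => σ p.1 p.2) P,
    ← RingHom.mem_ker, ← RingHom.mem_ker]
  change MvPolynomial.map θ P ∈ RingHom.ker (MvPolynomial.aeval fun p : ℕ+ × Fin n => ρ' p.1 p.2) ↔
    MvPolynomial.map θ P ∈ RingHom.ker (MvPolynomial.aeval fun p : ℕ+ × Fin n => σ' p.1 p.2)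
  rw [hker']

end Literature.FieldTheory.Kummer
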